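import Summits.Ventures.Crystal3D.Theorems.StickyWulffConstantGenericWallFloorMixedDozenRules
import Summits.Ventures.Crystal3D.Theorems.StickyWulffConstantGenericWallFloorSealing
import HarnessLib

/-!
# The filling touches at most the inner face of a clamped slab sample:
# `cross(P, X \ P) ≤ 2 φ(A⁻¹e₃) π ρ² + C ρ`

HONEST FRAMING. Part of the venture `Summits/Ventures/Crystal3D` (cell `crystal3d-full`), helper
`--supports` the crux `GenericWallFloor` (stmt-Ventures-19480, route
`route-Ventures-StickyWulffConstant`, line `WallLedgerG`, stub `stub_twoSlabAdhesion`).  ZERO-CHARGE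
rung of the two-slab adhesion ledger, substrate side: for a complete slab sample `P = Λ ∩ ([a,b] ×
disc ρ)` of a moved fcc lattice `Λ = A·Λ₀ + t` (`b − a = R ≥ 3`, `ρ ≥ R`) inside a unit-separated
`X` all of whose points lie at height `≥ a` (BOTTOM CLAMP), the number of cross contacts
`#{(p, q) ∈ P × (X \ P) : dist p q = 1}` is at most `2 φ(A⁻¹e₃) π ρ² + C ρ` with `C = C(A, R)` — the
inner face's vacant slots, whatever the filling (lattice, twin, amorphous).

Proof (slot ledger + sealing): a sample ball `p` has at most `12` partners (kissing number,
`card_partners_le_twelve`), its partners inside `P` are its occupied slots; by the sealing lemma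
(`sealing_below`, file `…GenericWallFloorSealing`) a DEEP ball (`p₂ ≤ b − 2`, lateral radius
`≤ ρ − 2`) has no foreign partner at all, and a SKIN ball (`p₂ > b − 2`, lateral `≤ ρ − 2`) has all
its downward and horizontal slots occupied (completeness of the sample, `R ≥ 3`), so its foreign
partners number at most its empty UPWARD slots; summing, the empty upward slots of class `w`
(`⟪w, ν⟫ > 0`, `ν = A⁻¹e₃`) are bounded by the line count `card_filter_add_notMem_le_lineCount`
(module M1 of 19480-p1's rigid rung, with the charts `exists_chart_of_mem_fccSlots`), and
`Σ_{⟪w,ν⟫>0} |⟪w,ν⟫| ≤ ½ Σ_w |⟪w,ν⟫|` (`sum_pos_abs_inner_le_half`) turns `√2 π ρ² Σ_{up}` into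
`2 φ π ρ²`; rim balls (lateral `> ρ − 2`) contribute `≤ 12 · 48 (R+2) ρ` by the shell count.

* `sum_pos_abs_inner_le_half` — slot bookkeeping (`neg_mem_fccSlots` of `…MixedDozenRules`);
* `cross_le_innerFace_floor` — the theorem (bottom clamp).  The top clamp and the zero-charge
  two-slab / wall-floor corollaries are in `…GenericWallFloorZeroCharge`.

WHAT THIS IS NOT: no charge is extracted from the interface (this is `c₀ = 0`, not the crux's
`c₀ = 1`); rung F-C1 not moved.
-/

noncomputable section

namespace Summit.Ventures.Crystal3D.Theorems

open Summit.Ventures.Crystal3D Finset Matrix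
open Literature.MathematicalPhysics.StatisticalMechanics (barlowPos fccStacking constHagg
  haggLabel_const barlowPos_mem isHaggSeq_const contactDeficiency)
open scoped InnerProductSpace

/-! ## Slot bookkeeping -/

/-- **Half of the bond flux points up:** `Σ_{⟪w,ν⟫ > 0} |⟪w,ν⟫| ≤ ½ Σ_{w} |⟪w,ν⟫|` over the
twelve slots (in fact equality, by `w ↦ −w`). -/
theorem sum_pos_abs_inner_le_half (ν : EuclideanSpace ℝ (Fin 3)) :
    ∑ w ∈ fccSlots.filter (fun w => 0 < ⟪w, ν⟫_ℝ), |⟪w, ν⟫_ℝ| ≤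
      1 / 2 * ∑ w ∈ fccSlots, |⟪w, ν⟫_ℝ| := by
  classical
  -- the positive and the negative classes have the same sum
  have hbij : ∑ w ∈ fccSlots.filter (fun w => 0 < ⟪w, ν⟫_ℝ), |⟪w, ν⟫_ℝ| =
      ∑ w ∈ fccSlots.filter (fun w => ⟪w, ν⟫_ℝ < 0), |⟪w, ν⟫_ℝ| := by
    refine Finset.sum_nbij' (fun w => -w) (fun w => -w) ?_ ?_ (fun w _ => neg_neg w)
      (fun w _ => neg_neg w) ?_
    · intro w hw
      rw [mem_filter] at hw ⊢
      refine ⟨neg_mem_fccSlots hw.1, ?_⟩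
      rw [inner_neg_left]; linarith [hw.2]
    · intro w hw
      rw [mem_filter] at hw ⊢
      refine ⟨neg_mem_fccSlots hw.1, ?_⟩
      rw [inner_neg_left]; linarith [hw.2]
    · intro w _
      rw [inner_neg_left, abs_neg]
  have hsplit := Finset.sum_filter_add_sum_filter_not fccSlots (fun w => 0 < ⟪w, ν⟫_ℝ)
    (fun w => |⟪w, ν⟫_ℝ|)
  have hsub : fccSlots.filter (fun w => ⟪w, ν⟫_ℝ < 0) ⊆
      fccSlots.filter (fun w => ¬ 0 < ⟪w, ν⟫_ℝ) := by
    intro w hw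
    rw [mem_filter] at hw ⊢
    exact ⟨hw.1, by linarith [hw.2]⟩
  have hle : ∑ w ∈ fccSlots.filter (fun w => ⟪w, ν⟫_ℝ < 0), |⟪w, ν⟫_ℝ| ≤
      ∑ w ∈ fccSlots.filter (fun w => ¬ 0 < ⟪w, ν⟫_ℝ), |⟪w, ν⟫_ℝ| :=
    Finset.sum_le_sum_of_subset_of_nonneg hsub fun w _ _ => abs_nonneg _
  linarith

/-! ## The inner-face bound (bottom clamp) -/

set_option maxHeartbeats 400000 in
/-- **The filling touches at most the inner face (bottom clamp).**  For `Λ = A·Λ₀ + t` and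
`R ≥ 3` there is `C` such that for every window `[a, b]`, `b − a = R`, every `ρ ≥ R`, every finite
unit-separated `X` lying at height `≥ a` and the complete sample
`P = {p ∈ Λ : a ≤ p₂ ≤ b, p₀² + p₁² ≤ ρ²} ⊆ X`:
`#{(p, q) ∈ P × (X \ P) : dist p q = 1} ≤ 2 φ(A⁻¹e₃) π ρ² + C ρ`. -/
theorem cross_le_innerFace_floor
    (A : EuclideanSpace ℝ (Fin 3) ≃ₗᵢ[ℝ] EuclideanSpace ℝ (Fin 3)) (t : EuclideanSpace ℝ (Fin 3))
    (R : ℝ) (hR : 3 ≤ R) : ∃ C : ℝ, ∀ a b : ℝ, b - a = R → ∀ ρ : ℝ, R ≤ ρ →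
      ∀ X P : Finset (EuclideanSpace ℝ (Fin 3)),
        (∀ p ∈ X, ∀ q ∈ X, p ≠ q → 1 ≤ dist p q) → P ⊆ X → (∀ q ∈ X, a ≤ q 2) →
        (∀ p, p ∈ P ↔ (p ∈ (fun q => A q + t) '' fccStacking 1 (Real.sqrt (2 / 3)) ∧
          a ≤ p 2 ∧ p 2 ≤ b ∧ p 0 ^ 2 + p 1 ^ 2 ≤ ρ ^ 2)) →
        ((((P ×ˢ (X \ P)).filter fun pq => dist pq.1 pq.2 = 1).card : ℕ) : ℝ) ≤
          2 * (Real.sqrt 2 / 4 * ∑ᶠ w ∈ {w ∈ fccStacking 1 (Real.sqrt (2 / 3)) | ‖w‖ = 1},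
            |⟪w, A.symm (EuclideanSpace.single (2 : Fin 3) (1 : ℝ))⟫_ℝ|) * Real.pi * ρ ^ 2 +
            C * ρ := by
  classical
  set e₃ : EuclideanSpace ℝ (Fin 3) := EuclideanSpace.single (2 : Fin 3) (1 : ℝ) with he₃
  set ν : EuclideanSpace ℝ (Fin 3) := A.symm e₃ with hν
  set s : EuclideanSpace ℝ (Fin 3) := A.symm t with hs
  set K : ℝ := R / 2 + 4 with hK
  set cst : EuclideanSpace ℝ (Fin 3) → ℝ := fun w =>
    if ⟪w, ν⟫_ℝ = 0 then 0
    else 2 * Real.sqrt 2 * Real.pi * K + Real.sqrt 2 * Real.pi * K ^ 2 / |⟪w, ν⟫_ℝ| with hcst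
  refine ⟨∑ w ∈ fccSlots, cst w + 576 * (R + 2), ?_⟩
  intro a b hab ρ hρ X P hX hPX hfloor hP
  have hρ3 : 3 ≤ ρ := hR.trans hρ
  have hρ1 : 1 ≤ ρ := by linarith
  have hρ0 : 0 ≤ ρ := by linarith
  have hR0 : 0 ≤ R := by linarith
  have he₃n : ‖e₃‖ = 1 := by rw [he₃, PiLp.norm_single, norm_one]
  have hνn : ‖ν‖ = 1 := by rw [hν, LinearIsometryEquiv.norm_map, he₃n]
  have hAν : A ν = e₃ := by rw [hν, LinearIsometryEquiv.apply_symm_apply]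
  have hAs : A s = t := by rw [hs, LinearIsometryEquiv.apply_symm_apply]
  have hρsq : (ρ - 2 + 1) ^ 2 ≤ ρ ^ 2 := by nlinarith
  -- the motion, its inverse, coordinates (as in `affineSampleDeficit_upper`)
  set g : EuclideanSpace ℝ (Fin 3) → EuclideanSpace ℝ (Fin 3) := fun q => A q + t with hg
  set ginv : EuclideanSpace ℝ (Fin 3) → EuclideanSpace ℝ (Fin 3) := fun p => A.symm (p - t)
    with hginv
  have hg_ginv : ∀ p, g (ginv p) = p := by
    intro p; simp only [hg, hginv, LinearIsometryEquiv.apply_symm_apply]; abel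
  have hginv_g : ∀ q, ginv (g q) = q := by
    intro q; simp only [hg, hginv, add_sub_cancel_right, LinearIsometryEquiv.symm_apply_apply]
  have hginv_inj : Function.Injective ginv := by
    intro p q h; have := congrArg g h; rwa [hg_ginv, hg_ginv] at this
  have hgq : ∀ q, g q = A (q + s) := by intro q; simp only [hg, map_add, hAs]
  have h2 : ∀ q, g q 2 = ⟪q + s, ν⟫_ℝ := by
    intro q
    have : g q 2 = ⟪g q, e₃⟫_ℝ := by rw [he₃, EuclideanSpace.inner_single_right]; simp
    rw [this, hgq, ← hAν, LinearIsometryEquiv.inner_map_map]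
  have hlat : ∀ q, g q 0 ^ 2 + g q 1 ^ 2 = ‖q + s‖ ^ 2 - ⟪q + s, ν⟫_ℝ ^ 2 := by
    intro q
    rw [sq_add_sq_eq_norm_sq_sub, ← he₃, hgq, LinearIsometryEquiv.norm_map, ← hAν,
      LinearIsometryEquiv.inner_map_map]
  -- the pulled-back sample
  set P' : Finset (EuclideanSpace ℝ (Fin 3)) := P.image ginv with hP'
  have hmemP' : ∀ q, q ∈ P' ↔ g q ∈ P := by
    intro q; rw [hP', mem_image]
    constructor
    · rintro ⟨p, hp, rfl⟩; rw [hg_ginv]; exact hp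
    · intro hq; exact ⟨g q, hq, hginv_g q⟩
  have himg : ∀ q, g q ∈ (fun q => A q + t) '' fccStacking 1 (Real.sqrt (2 / 3)) ↔
      q ∈ fccStacking 1 (Real.sqrt (2 / 3)) := by
    intro q; constructor
    · rintro ⟨q', hq', hqq'⟩
      have : q' = q := by
        have h1 : ginv (g q') = ginv (g q) := congrArg ginv hqq'
        rwa [hginv_g, hginv_g] at h1
      rw [← this]; exact hq'
    · intro hq; exact ⟨q, hq, rfl⟩
  have hP'iff : ∀ q, q ∈ P' ↔ (q ∈ fccStacking 1 (Real.sqrt (2 / 3)) ∧ a ≤ ⟪q + s, ν⟫_ℝ ∧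
      ⟪q + s, ν⟫_ℝ ≤ a + R ∧ ‖q + s‖ ^ 2 - ⟪q + s, ν⟫_ℝ ^ 2 ≤ ρ ^ 2) := by
    intro q; rw [hmemP', hP (g q), h2, hlat, ← hab, add_sub_cancel, himg]
  have hP'fcc : ∀ q ∈ P', q ∈ fccStacking 1 (Real.sqrt (2 / 3)) := fun q hq => ((hP'iff q).1 hq).1
  -- cross as a sum of foreign-partner counts
  set F : EuclideanSpace ℝ (Fin 3) → ℝ := fun p => (((X \ P).filter fun q => dist p q = 1).card : ℝ)
    with hF
  have hcross : ((((P ×ˢ (X \ P)).filter fun pq => dist pq.1 pq.2 = 1).card : ℕ) : ℝ) =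
      ∑ p ∈ P, F p := by
    rw [card_crossContacts_eq_sum_sum]
    refine sum_congr rfl fun p _ => ?_
    simp only [hF, card_filter, Nat.cast_sum, Nat.cast_ite, Nat.cast_one, Nat.cast_zero]
  rw [hcross]
  -- the empty upward slots of the pulled-back point
  set up : Finset (EuclideanSpace ℝ (Fin 3)) := fccSlots.filter (fun w => 0 < ⟪w, ν⟫_ℝ) with hup
  set G : EuclideanSpace ℝ (Fin 3) → ℝ := fun p => ((up.filter fun w => ginv p + w ∉ P').card : ℝ)
    with hG
  -- F ≤ 12 everywhere
  have hF12 : ∀ p, F p ≤ 12 := by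
    intro p
    have hsub : (X \ P).filter (fun q => dist p q = 1) ⊆ X.filter (fun q => dist p q = 1) :=
      filter_subset_filter _ sdiff_subset
    have := (card_le_card hsub).trans (card_partners_le_twelve X hX p)
    simp only [hF]; exact_mod_cast this
  have hF0 : ∀ p, 0 ≤ F p := fun p => by simp only [hF]; positivity
  have hG0 : ∀ p, 0 ≤ G p := fun p => by simp only [hG]; positivity
  -- core and rim
  set core := P.filter (fun p => p 0 ^ 2 + p 1 ^ 2 ≤ (ρ - 2) ^ 2) with hcore
  set rim := P.filter (fun p => ¬ p 0 ^ 2 + p 1 ^ 2 ≤ (ρ - 2) ^ 2) with hrim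
  have hPsplit : ∑ p ∈ P, F p = ∑ p ∈ core, F p + ∑ p ∈ rim, F p :=
    (sum_filter_add_sum_filter_not P _ F).symm
  -- (1) rim: at most `48 (R+2) ρ` balls, `12` partners each
  have hrim_card : (rim.card : ℝ) ≤ 48 * (R + 2) * ρ := by
    have hsep : ∀ p ∈ rim, ∀ q ∈ rim, p ≠ q → 1 ≤ dist p q :=
      fun p hp q hq hpq => hX p (hPX (mem_filter.1 hp).1) q (hPX (mem_filter.1 hq).1) hpq
    have hmem : ∀ p ∈ rim, a ≤ p 2 ∧ p 2 ≤ b ∧ (ρ - 2) ^ 2 < p 0 ^ 2 + p 1 ^ 2 ∧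
        p 0 ^ 2 + p 1 ^ 2 ≤ ρ ^ 2 := by
      intro p hp
      obtain ⟨hpP, hpr⟩ := mem_filter.1 hp
      obtain ⟨-, h1, h2', h3⟩ := (hP p).1 hpP
      exact ⟨h1, h2', lt_of_not_ge hpr, h3⟩
    have hshell := card_mul_le_of_separated_in_shell rim hsep a b (ρ - 2) ρ (by linarith)
      (by linarith) (by linarith) hmem
    have hring : (b - a + 2) * (Real.pi * (ρ + 1) ^ 2 - Real.pi * (ρ - 2 - 1) ^ 2) =
        Real.pi * ((R + 2) * (8 * ρ - 8)) := by rw [hab]; ring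
    rw [hring] at hshell
    by_contra hcon
    push Not at hcon
    nlinarith [Real.pi_pos, Real.pi_gt_three, hshell, hcon]
  have hrim_sum : ∑ p ∈ rim, F p ≤ 576 * (R + 2) * ρ := by
    have h1 : ∑ p ∈ rim, F p ≤ ∑ p ∈ rim, (12 : ℝ) := sum_le_sum fun p _ => hF12 p
    rw [sum_const, nsmul_eq_mul] at h1
    nlinarith [h1, hrim_card]
  -- (2) core: `F ≤ G` pointwise
  have hcoreFG : ∀ p ∈ core, F p ≤ G p := by
    intro p hp
    obtain ⟨hpP, hpr⟩ := mem_filter.1 hp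
    obtain ⟨hpΛ, hpa, hpb, hpρ⟩ := (hP p).1 hpP
    by_cases hdeep : p 2 ≤ b - 2
    · -- deep ball: no foreign partner at all (sealing)
      have hempty : (X \ P).filter (fun q => dist p q = 1) = ∅ := by
        rw [filter_eq_empty_iff]
        intro q hq hd
        rw [mem_sdiff] at hq
        have hd' : dist q p ≤ 1 := by rw [dist_comm]; exact hd.le
        have hqz : q 2 ≤ b - 1 := by
          have h1 : (q 2 - p 2) ^ 2 ≤ 1 ^ 2 := by
            have := sq_sub_apply_le_dist_sq q p 2
            have h1' : dist q p ^ 2 ≤ 1 ^ 2 := pow_le_pow_left₀ dist_nonneg hd' 2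
            exact this.trans h1'
          have := (abs_le_of_sq_le_sq' h1 zero_le_one).2
          linarith
        have hqr : q 0 ^ 2 + q 1 ^ 2 ≤ (ρ - 1) ^ 2 := by
          have := lateral_sq_le_of_dist_le_one (y := q) (q := p) (r := ρ - 2) (by linarith) hpr hd'
          have e : ρ - 2 + 1 = ρ - 1 := by ring
          rwa [e] at this
        exact sealing_below A t a b ρ hρ1 X P hX hPX hP q hq.1 hq.2 (hfloor q hq.1) hqz hqr
      have hF0' : F p = 0 := by
        show ((((X \ P).filter fun q => dist p q = 1).card : ℕ) : ℝ) = 0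
        rw [hempty, card_empty, Nat.cast_zero]
      rw [hF0']
      exact hG0 p
    · -- skin ball: foreign partners ≤ empty upward slots
      push Not at hdeep
      have hp'P : ginv p ∈ P' := by rw [hmemP', hg_ginv]; exact hpP
      have hp'Λ := hP'fcc (ginv p) hp'P
      have hgw : ∀ w, g (ginv p + w) = p + A w := by
        intro w
        calc g (ginv p + w) = g (ginv p) + A w := by simp only [hg, map_add]; abel
          _ = p + A w := by rw [hg_ginv]
      -- partners of `p` in `X` split over `P` and `X \ P`, at most twelve in all
      have hXsplit : ((X.filter fun q => dist p q = 1).card : ℝ) =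
          ((P.filter fun q => dist p q = 1).card : ℝ) + F p := by
        have hXeq : X = P ∪ (X \ P) := (union_sdiff_of_subset hPX).symm
        have hdisj : Disjoint (P.filter fun q => dist p q = 1)
            ((X \ P).filter fun q => dist p q = 1) :=
          disjoint_filter_filter disjoint_sdiff
        have hc : (X.filter fun q => dist p q = 1).card = (P.filter fun q => dist p q = 1).card +
            ((X \ P).filter fun q => dist p q = 1).card := by
          conv_lhs => rw [hXeq, filter_union, card_union_of_disjoint hdisj]
        rw [hc]; push_cast; rfl
      have h12 : ((X.filter fun q => dist p q = 1).card : ℝ) ≤ 12 := by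
        exact_mod_cast card_partners_le_twelve X hX p
      -- occupied slots of `ginv p` inject into the partners of `p` inside `P`
      have hocc : ((fccSlots.filter fun w => ginv p + w ∈ P').card : ℝ) ≤
          ((P.filter fun q => dist p q = 1).card : ℝ) := by
        have h := Finset.card_le_card_of_injOn (fun w => p + A w) (fun w hw => ?_) ?_
          (s := fccSlots.filter fun w => ginv p + w ∈ P') (t := P.filter fun q => dist p q = 1)
        · exact_mod_cast h
        · simp only [Finset.mem_coe, mem_filter] at hw ⊢
          obtain ⟨hwS, hwP⟩ := hw
          refine ⟨?_, ?_⟩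
          · rw [← hgw]; exact (hmemP' _).1 hwP
          · rw [dist_eq_norm, sub_add_cancel_left, norm_neg, LinearIsometryEquiv.norm_map,
              norm_eq_one_of_mem_fccSlots hwS]
        · intro w₁ _ w₂ _ h
          have : A w₁ = A w₂ := add_left_cancel h
          exact A.injective this
      -- every slot is occupied or an empty UPWARD slot
      have hcover : fccSlots ⊆ (fccSlots.filter fun w => ginv p + w ∈ P') ∪
          (up.filter fun w => ginv p + w ∉ P') := by
        intro w hw
        rw [mem_union, mem_filter, mem_filter, hup, mem_filter]
        by_cases hwP : ginv p + w ∈ P'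
        · exact Or.inl ⟨hw, hwP⟩
        · refine Or.inr ⟨⟨hw, ?_⟩, hwP⟩
          -- a downward or horizontal slot of a skin ball is occupied (completeness, `R ≥ 3`)
          by_contra hdown
          push Not at hdown
          apply hwP
          rw [hP'iff]
          have hwn : ‖w‖ = 1 := norm_eq_one_of_mem_fccSlots hw
          have hwν : -1 ≤ ⟪w, ν⟫_ℝ := by
            have h := abs_real_inner_le_norm w ν
            rw [hwn, hνn, one_mul] at h
            linarith [neg_abs_le ⟪w, ν⟫_ℝ]
          have hinn : ⟪ginv p + w + s, ν⟫_ℝ = ⟪ginv p + s, ν⟫_ℝ + ⟪w, ν⟫_ℝ := by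
            rw [show ginv p + w + s = (ginv p + s) + w by abel, inner_add_left]
          have hpz : ⟪ginv p + s, ν⟫_ℝ = p 2 := by rw [← h2, hg_ginv]
          have hdist : dist (p + A w) p ≤ 1 := by
            rw [dist_eq_norm, add_sub_cancel_left, LinearIsometryEquiv.norm_map, hwn]
          have hlatw : (p + A w) 0 ^ 2 + (p + A w) 1 ^ 2 ≤ (ρ - 2 + 1) ^ 2 :=
            lateral_sq_le_of_dist_le_one (y := p + A w) (q := p) (r := ρ - 2) (by linarith) hpr
              hdist
          refine ⟨add_mem_fcc_of_mem_fccSlots hp'Λ hw, ?_, ?_, ?_⟩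
          · rw [hinn, hpz]; linarith
          · rw [hinn, hpz]; linarith
          · rw [← hlat (ginv p + w), hgw]; exact hlatw.trans hρsq
      have hcard12 : (12 : ℝ) ≤ ((fccSlots.filter fun w => ginv p + w ∈ P').card : ℝ) + G p := by
        have h := (card_le_card hcover).trans (card_union_le _ _)
        rw [card_fccSlots] at h
        have hGp : G p = ((up.filter fun w => ginv p + w ∉ P').card : ℝ) := rfl
        rw [hGp]
        exact_mod_cast h
      linarith
  have hcore_sum : ∑ p ∈ core, F p ≤ ∑ p ∈ P, G p :=
    (sum_le_sum hcoreFG).trans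
      (sum_le_sum_of_subset_of_nonneg (filter_subset _ _) fun p _ _ => hG0 p)
  -- (3) swap the sums: `Σ_p G p = Σ_{w ∈ up} #{p' ∈ P' : p' + w ∉ P'}`
  have hswap : ∑ p ∈ P, G p = ∑ w ∈ up, ((P'.filter fun q => q + w ∉ P').card : ℝ) := by
    have hG' : ∀ p ∈ P, G p = ∑ w ∈ up, (if ginv p + w ∉ P' then (1 : ℝ) else 0) := by
      intro p _
      simp only [hG, card_filter, Nat.cast_sum, Nat.cast_ite, Nat.cast_one, Nat.cast_zero]
    rw [sum_congr rfl hG', sum_comm]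
    refine sum_congr rfl fun w _ => ?_
    have himage : P'.filter (fun q => q + w ∉ P') =
        (P.filter fun p => ginv p + w ∉ P').image ginv := by
      rw [hP', filter_image]
    rw [himage, card_image_of_injective _ hginv_inj, card_filter]
    push_cast
    rfl
  -- (4) per-slot line counts
  have hslot : ∀ w ∈ up, ((P'.filter fun q => q + w ∉ P').card : ℝ) ≤
      Real.sqrt 2 * |⟪w, ν⟫_ℝ| * Real.pi * ρ ^ 2 + cst w * ρ := by
    intro w hw
    obtain ⟨hwS, hwpos⟩ := mem_filter.1 hw
    have hα : ⟪w, ν⟫_ℝ ≠ 0 := ne_of_gt hwpos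
    obtain ⟨Ea, Eb, hEa, hEb, hdet, fa, fb, ft, hchart⟩ := exists_chart_of_mem_fccSlots hwS
    have hcw : cst w =
        2 * Real.sqrt 2 * Real.pi * K + Real.sqrt 2 * Real.pi * K ^ 2 / |⟪w, ν⟫_ℝ| := by
      simp only [hcst, hα, if_false]
    have hcount := card_filter_add_notMem_le_lineCount ν s hνn a R ρ hR0 hρ0 P' hP'iff Ea Eb w
      hEa hEb (norm_eq_one_of_mem_fccSlots hwS) hdet hα hwS fa fb ft hchart
    rw [hcw]
    have hαpos : 0 < |⟪w, ν⟫_ℝ| := abs_pos.2 hα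
    have hexp : Real.sqrt 2 * |⟪w, ν⟫_ℝ| * Real.pi * (ρ + (R / 2 + 4) / |⟪w, ν⟫_ℝ|) ^ 2 =
        Real.sqrt 2 * |⟪w, ν⟫_ℝ| * Real.pi * ρ ^ 2 + 2 * Real.sqrt 2 * Real.pi * K * ρ +
          Real.sqrt 2 * Real.pi * K ^ 2 / |⟪w, ν⟫_ℝ| := by
      rw [← hK]; field_simp; ring
    rw [hexp] at hcount
    have hK0 : 0 ≤ Real.sqrt 2 * Real.pi * K ^ 2 / |⟪w, ν⟫_ℝ| := by positivity
    have hK1 : Real.sqrt 2 * Real.pi * K ^ 2 / |⟪w, ν⟫_ℝ| ≤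
        Real.sqrt 2 * Real.pi * K ^ 2 / |⟪w, ν⟫_ℝ| * ρ := le_mul_of_one_le_right hK0 hρ1
    have hring : (2 * Real.sqrt 2 * Real.pi * K + Real.sqrt 2 * Real.pi * K ^ 2 / |⟪w, ν⟫_ℝ|) * ρ =
        2 * Real.sqrt 2 * Real.pi * K * ρ + Real.sqrt 2 * Real.pi * K ^ 2 / |⟪w, ν⟫_ℝ| * ρ := by
      ring
    rw [hring]
    linarith [hcount, hK1]
  have hcst0 : ∀ w, 0 ≤ cst w := by
    intro w
    simp only [hcst]
    split_ifs
    · exact le_rfl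
    · positivity
  have hup_sum : ∑ w ∈ up, ((P'.filter fun q => q + w ∉ P').card : ℝ) ≤
      Real.sqrt 2 * Real.pi * ρ ^ 2 * ∑ w ∈ up, |⟪w, ν⟫_ℝ| + ρ * ∑ w ∈ fccSlots, cst w := by
    have h1 : ∑ w ∈ up, ((P'.filter fun q => q + w ∉ P').card : ℝ) ≤
        ∑ w ∈ up, (Real.sqrt 2 * |⟪w, ν⟫_ℝ| * Real.pi * ρ ^ 2 + cst w * ρ) := sum_le_sum hslot
    have h2' : ∑ w ∈ up, (Real.sqrt 2 * |⟪w, ν⟫_ℝ| * Real.pi * ρ ^ 2 + cst w * ρ) =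
        Real.sqrt 2 * Real.pi * ρ ^ 2 * ∑ w ∈ up, |⟪w, ν⟫_ℝ| + ρ * ∑ w ∈ up, cst w := by
      rw [sum_add_distrib, mul_sum, mul_sum]
      congr 1 <;> refine sum_congr rfl fun w _ => by ring
    have h3 : ∑ w ∈ up, cst w ≤ ∑ w ∈ fccSlots, cst w :=
      sum_le_sum_of_subset_of_nonneg (filter_subset _ _) fun w _ _ => hcst0 w
    have h4 : ρ * ∑ w ∈ up, cst w ≤ ρ * ∑ w ∈ fccSlots, cst w := mul_le_mul_of_nonneg_left h3 hρ0
    linarith [h1, h2', h4]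
  -- (5) assemble
  have hhalf := sum_pos_abs_inner_le_half ν
  rw [finsum_unit_fcc_eq_sum]
  have hS0 : 0 ≤ ∑ w ∈ fccSlots, |⟪w, ν⟫_ℝ| := sum_nonneg fun w _ => abs_nonneg _
  have hpos2 : 0 ≤ Real.sqrt 2 * Real.pi * ρ ^ 2 := by positivity
  have hkey : Real.sqrt 2 * Real.pi * ρ ^ 2 * ∑ w ∈ up, |⟪w, ν⟫_ℝ| ≤
      Real.sqrt 2 * Real.pi * ρ ^ 2 * (1 / 2 * ∑ w ∈ fccSlots, |⟪w, ν⟫_ℝ|) :=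
    mul_le_mul_of_nonneg_left hhalf hpos2
  have htot : ∑ p ∈ P, F p ≤ Real.sqrt 2 * Real.pi * ρ ^ 2 * (1 / 2 * ∑ w ∈ fccSlots, |⟪w, ν⟫_ℝ|) +
      ρ * ∑ w ∈ fccSlots, cst w + 576 * (R + 2) * ρ := by
    rw [hPsplit]; linarith [hcore_sum, hswap, hup_sum, hrim_sum, hkey]
  refine htot.trans (le_of_eq ?_)
  ring

end Summit.Ventures.Crystal3D.Theorems

end
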